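import Summits.QuantumFields.YangMills.Theorems.BalabanUVNodesN20CoreEdgeAtReadingOfRecord13CoPH
import Summits.QuantumFields.YangMills.Theorems.BalabanUVNodesSpineReadingOfRecord13CoPHV

/-!
# BalabanUVNodes ∕ N20 (NE7b) — the `hedge`-JOINT COMPANION, module 6: N19's core edge AT THE PHYSICAL-VOLUME READING `crOfRecord₁₃V` (dag-n20-d, `vol := F.side ^ 4`,
# `Thm/BalabanUVNodesSpineReadingOfRecord13CoPHV`) from the lifted-term sandwich — module 5 §2 (volume-generic) at `(l₀, vol) := (1, F.side ^ 4)`, fed to n20-d's `core_crOfRecord₁₃VAt`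

Cell `pub-ymgap` (HUMAN RULING D-0062 Track A; D-0149 width push), seat `pub-ymgap-dag-n20-w3` (WIDTH SEAT 3 of 3 on NODE n20 = NE7b) gen 0; trigger (t4) of this seat's HANDOFF
(dag-n20-d's VOL re-pin, INBOX l.25415: the physical volume letter `vol := F.side ^ 4` — the top lattice's site count, dag-n19-d DESIGN-POINT-VOL l.25098 — lives in the SIBLING
reading `crOfRecord₁₃V`, the `vol := 1` reading `crOfRecord₁₃` being frozen by the append-only rule).  Filed `--kind proof --supports stmt-QuantumFields-20544 --as helper`;
COUNT-NEUTRAL.  [III] = [Balaban1988Convergent], [LF-II] = [Balaban1989LargeFieldII].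

WHAT.  ★★ `core_crOfRecord₁₃VAt_of_liftedTerm` — DISPLAYED: `hM : 0 < θ.τ9.M`, the flow hypothesis `hR` on the record's histories `histA₁₃ ∕ histB₁₃`, the policy letters
`1 ≤ jcut K ≤ K₀ + K`, the shell split `sh`, a summable `δ`, n20-d's non-negativity letter `hP0` on the good class, and THE LIFTED-TERM SANDWICH with the physical volume in the
exponent, `e^{c ∓ F.side^4·δ K}`: «run A's dressed class weight of `s` vs run B's of `liftSeq s`, minus the shells» on every run-A (2.18) sequence that is small-field at every
level `≤ jcut K` (N19's NE7 core at the record — NOT PRINTED, NOT proved); CONCLUSION: `NE7.Core` at `crOfRecord₁₃VAt K₀ jcut sh …`'s own carriers, bad class and canonical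
rate, `∧ Summable` (module 5's `core_reading₁₃_iff_liftedTerm` at `(1, F.side ^ 4)` + n20-d's `core_crOfRecord₁₃VAt` BY NAME).  Nothing re-typed.

(α) READING ∕ LOCATED banner: as in modules 2∕4∕5 — `badClass₁₃` reads «old AND pending» iff the record's 𝐑-selector `θ.ppSel` is history-rewriting ((ρ2), the design); under an
identity∕junk pin it is «ever created» and `KeyedRelWeight` at it is asymptotically unsatisfiable (evidence #10 on stmt-QuantumFields-20544); at the zero cut the N20 conjunct is
free (n20-w2 LOCATED l.25602) — the `∃ jcut` of K3⁷ v2's stub 2 is a free dial between the weight face and this core edge (module 2 §3b).  NC-NE7b-α UNRULED.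

HONEST FRAMING.  Count-neutral one-step bookkeeping.  It proves NO estimate; NE7 ∕ NE7b NOT PRINTED for `d = 4` ([LF-II] p.356) ∕ NOT PROVED; (α)-instance 0∕1; N19 ∕ N20 NOT
discharged; K3⁷ NOT closed; counts unmoved (typed 28∕28 · discharged 5∕27); no count claim.  One finite `𝕋⁴_{L^K}` programme at fixed `ε = L^{−K}` along two consecutive cutoffs,
Bałaban AS PRINTED; the YM mass gap (Clay) is NOT proved by any of this — R4 closes the conditional finite-𝕋⁴ rung `BalabanLadder.UV` only; NOT ℝ⁴, NOT OS.  No `instance`,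
no `notation`, no `def`, no `sorry`.
Sources (bookkeeping): [III] (2.18) p.257; [LF-II] Thm 1 + (0.1) pp.355–356; [King1986] (3.10) p.656.
-/

noncomputable section

namespace Summit.QuantumFields.YangMills.BalabanUVNodes.N20CoreEdgeAtReading13V

open Literature.MathematicalPhysics.QuantumFieldTheory.Balaban1983to89 Literature.MathematicalPhysics.QuantumFieldTheory.Balaban1983to89.T4Continuum
open Literature.MathematicalPhysics.QuantumFieldTheory.Balaban1983to89.Node00
open scoped BigOperators
open B14.Eq218Concrete Summit.QuantumFields.BalabanUV.T4Continuum.Spine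
open YMDAG.UVSplit
open Summit.QuantumFields.YangMills.BalabanUVNodes.N20CoreEdgeAtReading13 (core_reading₁₃_iff_liftedTerm)

variable {F : T4Family} {N : ℕ} [NeZero N]
variable (θ : Stage13HParams F N) (hP : θ.Provisos₁₃CoPH F N) (K₀ : ℕ) (g₀ : ℕ → ℝ) (os : List (ULoop F)) (hM : 0 < θ.τ9.M)

/-- **★★ N19′'s CORE EDGE AT THE PHYSICAL-VOLUME READING `crOfRecord₁₃VAt K₀ jcut sh` FROM THE LIFTED-TERM SANDWICH** (module 5 §2 at `(l₀, vol) := (1, F.side ^ 4)` + n20-d's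
`core_crOfRecord₁₃VAt`).  DISPLAYED: `hM`, `hR`, `1 ≤ jcut K ≤ K₀ + K`, `sh`, `hδ`, `hP0`, and the sandwich with exponent `c ∓ F.side^4·δ K` on the small-field-at-old-levels histories —
N19's NE7 core at the record, NOT PRINTED, NOT proved. [cite: King1986, (3.10) p.656; Balaban1989LargeFieldII, Thm 1 + (0.1) pp.355–356; Balaban1988Convergent, (2.18) p.257 (bookkeeping)] -/
theorem core_crOfRecord₁₃VAt_of_liftedTerm (hR : ∀ K, RAgree F θ.ν (histA₁₃ θ K₀ g₀ K) (histB₁₃ θ K₀ g₀ K) (K₀ + K))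
    (jcut : ℕ → ℕ) (hj1 : ∀ K, 1 ≤ jcut K) (hjK : ∀ K, jcut K ≤ K₀ + K) (sh : ShellSplit₁₃CoPH N K₀) {δ : ℕ → ℝ} (hδ : Summable δ)
    (hP0 : letI : DecidableEq (Σ K, SiteSeqKey F (K₀ + K)) := Classical.decEq _
      ∀ (K : ℕ) (t : ℝ), |t| ≤ 1 → ∀ x ∈ classSet₁₃ θ K₀ g₀ K \ badClass₁₃ θ K₀ g₀ jcut K t,
        0 ≤ weightA₁₃ θ hP K₀ g₀ os K t x - (sh F θ hP g₀ os).1 K t x)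
    (hlift : ∀ K : ℕ, ∃ c : ℝ, ∀ t : ℝ, |t| ≤ 1 → ∀ s : SeqOfRecord F θ.ν θ.τ9.M (histA₁₃ θ K₀ g₀ K) (K₀ + K) (K₀ + K),
      (∀ j, 1 ≤ j → j ≤ jcut K → s.Λ j = Set.univ) →
      Real.exp (c - F.side ^ 4 * δ K) *
            (classWeightOfDatum₉ F N θ.toStage9Params (datumOfRecord₁₃CoPH F N θ hP) g₀ os (runA₁₃ F K₀ g₀ K) (histA₁₃ θ K₀ g₀ K) (K₀ + K) t s
              - (sh F θ hP g₀ os).1 K t ⟨K, twoRunKeyA F θ.ν θ.τ9.M (histA₁₃ θ K₀ g₀ K) (K₀ + K) (K₀ + K) s⟩)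
          ≤ classWeightOfDatum₉ F N θ.toStage9Params (datumOfRecord₁₃CoPH F N θ hP) g₀ os (runB₁₃ F K₀ g₀ K) (histB₁₃ θ K₀ g₀ K) (K₀ + K + 1) t
                (liftSeq F θ.ν hM (hR K) s)
              - (sh F θ hP g₀ os).2 K t ⟨K, twoRunKeyA F θ.ν θ.τ9.M (histA₁₃ θ K₀ g₀ K) (K₀ + K) (K₀ + K) s⟩ ∧
        classWeightOfDatum₉ F N θ.toStage9Params (datumOfRecord₁₃CoPH F N θ hP) g₀ os (runB₁₃ F K₀ g₀ K) (histB₁₃ θ K₀ g₀ K) (K₀ + K + 1) t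
                (liftSeq F θ.ν hM (hR K) s)
              - (sh F θ hP g₀ os).2 K t ⟨K, twoRunKeyA F θ.ν θ.τ9.M (histA₁₃ θ K₀ g₀ K) (K₀ + K) (K₀ + K) s⟩
          ≤ Real.exp (c + F.side ^ 4 * δ K) *
            (classWeightOfDatum₉ F N θ.toStage9Params (datumOfRecord₁₃CoPH F N θ hP) g₀ os (runA₁₃ F K₀ g₀ K) (histA₁₃ θ K₀ g₀ K) (K₀ + K) t s
              - (sh F θ hP g₀ os).1 K t ⟨K, twoRunKeyA F θ.ν θ.τ9.M (histA₁₃ θ K₀ g₀ K) (K₀ + K) (K₀ + K) s⟩)) :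
    (letI := (crOfRecord₁₃VAt K₀ jcut sh F θ hP g₀ os).dec
     NE7.Core (crOfRecord₁₃VAt K₀ jcut sh F θ hP g₀ os).l₀ (crOfRecord₁₃VAt K₀ jcut sh F θ hP g₀ os).vol (crOfRecord₁₃VAt K₀ jcut sh F θ hP g₀ os).T
      (crOfRecord₁₃VAt K₀ jcut sh F θ hP g₀ os).Bad
      (fun K t τ => (crOfRecord₁₃VAt K₀ jcut sh F θ hP g₀ os).A K t τ - (crOfRecord₁₃VAt K₀ jcut sh F θ hP g₀ os).shA K t τ)
      (fun K t τ => (crOfRecord₁₃VAt K₀ jcut sh F θ hP g₀ os).B K t τ - (crOfRecord₁₃VAt K₀ jcut sh F θ hP g₀ os).shB K t τ)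
      (crOfRecord₁₃VAt K₀ jcut sh F θ hP g₀ os).δ) ∧ Summable (crOfRecord₁₃VAt K₀ jcut sh F θ hP g₀ os).δ :=
  core_crOfRecord₁₃VAt K₀ jcut sh θ hP g₀ os hP0
    ((core_reading₁₃_iff_liftedTerm θ hP K₀ g₀ os hM hR jcut hj1 hjK (sh F θ hP g₀ os) 1 (F.side ^ 4) δ).2 hlift) hδ

end Summit.QuantumFields.YangMills.BalabanUVNodes.N20CoreEdgeAtReading13V

end
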